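import Summits.QuantumFields.YangMills.Theorems.VirialFluxGapSheetKernelFix
import Summits.QuantumFields.YangMills.Theorems.VirialFluxGapRingGaugeAction
import HarnessLib

/-!
# Route `VirialFluxGap` (YangMills): the two GLOBAL-CONJUGATION tangents at a flat ring are EXACT KERNEL VECTORS of the frame Hessian —
# toward SIX orthonormal kernel vectors at a regular comb ring (upgrade (U3) of the generic divergence count `½(#ι − 4) → ½(#ι − 6)`)

LEAD ym-line-sfw-p2 g97 (cell ym-idea-1, free hands; `--supports stmt-QuantumFields-24196`).  The generic-region divergence package
✓`fix_generic_divergence_upper` counts `½(#ι − 4)` because ✓`exists_four_orthonormal_kernel_vectors` exhibits the four SHEET tangents only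
(angles of the three wrap holonomies and of the seam).  The flat valley of `X_fix` is 6-dimensional: the two GLOBAL CONJUGATIONS transverse to
the common axis move a regular comb ring inside the valley as well.  This file proves that at ANY zero `p` of `F₀` and for ANY `h ∈ 𝔰𝔲(2)` the
CONJUGATION DIRECTION `Y^h_w = P_w⁻¹·h·P_w − h` is an ISOTROPIC, hence KERNEL, vector of the raw frame Hessian — with no curve inside the valley
needed (the conjugation orbit is not a product of one-parameter subgroups):

* §1 `conjA h p` (`w ↦ P_w⁻¹hP_w`), `constDir h`, their skew-Hermitian ∕ traceless slots; `leftConst ∕ rightConst ∕ conjConst k p`;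
* §2 ★ `mul_multiCurve_conjA` — `p · exp(s·conjA h p) = e^{sh}·p` componentwise (`exp(s P⁻¹hP) = P⁻¹e^{sh}P`); `mul_multiCurve_constDir`;
  ★ `ringDeficit_leftConst_eq_rightConst` — `F₀(k·q) = F₀(q·k)` (constant gauge invariance ✓`ringDeficit_ringGaugeAct`);
* §3 ★★ `frameD_conj_pair_eq` — the two identities `Ĥ(A,A) = Ĥ(h,h)` and `Ĥ(A,h) = Ĥ(h,h)` at a zero (`A = conjA h p`, `h = constDir h`),
  from `F₀(e^{sh}·p·e^{th}) = F₀(p·e^{(s+t)h})` and the chain rule ✓`hasDerivAt_comp_multiCurve`;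
  ★★★ `frameD_conjDir_isotropic` — `Ĥ(A − h, A − h) = 0` (bilinearity via the two-slot family + ✓`frameD_frameD_symm_of_zero`);
* §4 ★★★ `frameHessRaw_mulVec_fixCoord_conjDir_eq_zero` ∕ `frameHess_…` — for the standard `X_fix` frame at any zero `p` with slice-`0` tree links `1`:
  `Ĥ(p)·fixCoord(conjA h p − constDir h) = 0` (✓`mulVec_eq_zero_of_nonneg_of_isotropic`, ✓`frameHessRaw_nonneg_of_zero`, ✓`dirOf_fixFrameStd_fixCoord`).
The orthogonality ∕ non-vanishing at axial comb rings and the six-vector package are the sequel file.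

HONEST LABEL: kernel bookkeeping for the sharp generic count; the rerun of the ⟨24141⟩ assembly with `m = 6` is NOT here; ⟨24196⟩ ∕ ⟨24194⟩ ∕
⟨24197⟩ OPEN; own crux ⟨22884⟩ OPEN (blocked-on ⟨19935⟩); the Yang–Mills mass gap is NOT proved; no summit is proved by a line.  Problem-side data
definitions (`conjA`, `constDir`, `leftConst`, `rightConst`, `conjConst`; no `Prop`), theorems otherwise; 0 `sorry`, standard axioms.
References: [cite: Luscher1983, §2] (toron valley); [folklore].
-/

set_option autoImplicit false

noncomputable section

open scoped Matrix BigOperators ContDiff Topology Quaternion Matrix.Norms.Frobenius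
open MeasureTheory Set Matrix
open Literature.MathematicalPhysics.QuantumFieldTheory hiding SU2
open Literature.MathematicalPhysics.QuantumLattice
open Literature.MathematicalPhysics.QuantumFieldTheory.SUNBakryEmery (expSU coe_expSU matTop)

namespace Summit.QuantumFields.YangMills.Theorems.VirialFluxGap.FixFrame

open Summit.QuantumFields.YangMills.Theorems.FemtoTransferGap
open Summit.QuantumFields.YangMills.Theorems.FemtoTransferGap.TT
open Summit.QuantumFields.YangMills.Theorems.FemtoTransferGap.TwoLattice
open Summit.QuantumFields.YangMills.Theorems.FemtoTransferGap.TwoLattice.Flat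
open Summit.QuantumFields.YangMills.Theorems.VirialFluxGap.RingDeficit
open Summit.QuantumFields.YangMills.Theorems.VirialFluxGap.FrameDerivative
open Summit.QuantumFields.YangMills.Theorems.VirialFluxGap.FrameHessian
open Summit.QuantumFields.YangMills.Theorems.VirialFluxGap.RegularValley

variable {L : ℕ} [NeZero L]

attribute [local instance 2000] Literature.MathematicalPhysics.QuantumFieldTheory.SUNBakryEmery.matTop

/-! ## §1 The conjugation directions and the constant left ∕ right ∕ conjugation actions -/

omit [NeZero L] in
/-- The matrix of the ring variable `w` at the ring history `p`. [folklore] -/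
def varMat (p : (Fin (2 * L - 1 + 1) → GaugeConfig 3 L SU2) × (Site 3 L → SU2)) (w : (Fin (2 * L - 1 + 1) × Edge 3 L) ⊕ Site 3 L) : SU2 :=
  Sum.elim (fun ie => p.1 ie.1 ie.2) (fun x => p.2 x) w

omit [NeZero L] in
/-- The direction `w ↦ P_w⁻¹·h·P_w` (the left translation by `h` read in the right-invariant frame). [folklore] -/
def conjA (h : Matrix (Fin 2) (Fin 2) ℂ) (p : (Fin (2 * L - 1 + 1) → GaugeConfig 3 L SU2) × (Site 3 L → SU2))
    (w : (Fin (2 * L - 1 + 1) × Edge 3 L) ⊕ Site 3 L) : Matrix (Fin 2) (Fin 2) ℂ :=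
  ((varMat p w : SU2) : Matrix (Fin 2) (Fin 2) ℂ)ᴴ * h * ((varMat p w : SU2) : Matrix (Fin 2) (Fin 2) ℂ)

omit [NeZero L] in
/-- The constant direction `w ↦ h`. [folklore] -/
def constDir (h : Matrix (Fin 2) (Fin 2) ℂ) (_w : (Fin (2 * L - 1 + 1) × Edge 3 L) ⊕ Site 3 L) : Matrix (Fin 2) (Fin 2) ℂ := h

omit [NeZero L] in
/-- Left multiplication of every variable by a constant `k`. [folklore] -/
def leftConst (k : SU2) (p : (Fin (2 * L - 1 + 1) → GaugeConfig 3 L SU2) × (Site 3 L → SU2)) :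
    (Fin (2 * L - 1 + 1) → GaugeConfig 3 L SU2) × (Site 3 L → SU2) :=
  ((fun i e => k * p.1 i e), fun x => k * p.2 x)

omit [NeZero L] in
/-- Right multiplication of every variable by a constant `k`. [folklore] -/
def rightConst (k : SU2) (p : (Fin (2 * L - 1 + 1) → GaugeConfig 3 L SU2) × (Site 3 L → SU2)) :
    (Fin (2 * L - 1 + 1) → GaugeConfig 3 L SU2) × (Site 3 L → SU2) :=
  ((fun i e => p.1 i e * k), fun x => p.2 x * k)

omit [NeZero L] in
/-- Conjugation of every variable by a constant `k` (a constant gauge transformation). [folklore] -/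
def conjConst (k : SU2) (p : (Fin (2 * L - 1 + 1) → GaugeConfig 3 L SU2) × (Site 3 L → SU2)) :
    (Fin (2 * L - 1 + 1) → GaugeConfig 3 L SU2) × (Site 3 L → SU2) :=
  ((fun i e => k * p.1 i e * k⁻¹), fun x => k * p.2 x * k⁻¹)

omit [NeZero L] in
/-- `Uᴴ·U = 1` for `U ∈ SU(2)` (matrices). [folklore] -/
theorem conjTranspose_coe_mul_coe (U : SU2) : ((U : Matrix (Fin 2) (Fin 2) ℂ))ᴴ * (U : Matrix (Fin 2) (Fin 2) ℂ) = 1 := by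
  have h := Matrix.mem_unitaryGroup_iff'.1 (Matrix.mem_specialUnitaryGroup_iff.1 U.2).1
  rwa [Matrix.star_eq_conjTranspose] at h

omit [NeZero L] in
/-- `U·Uᴴ = 1` for `U ∈ SU(2)` (matrices). [folklore] -/
theorem coe_mul_conjTranspose_coe (U : SU2) : (U : Matrix (Fin 2) (Fin 2) ℂ) * ((U : Matrix (Fin 2) (Fin 2) ℂ))ᴴ = 1 := by
  have h := Matrix.mem_unitaryGroup_iff.1 (Matrix.mem_specialUnitaryGroup_iff.1 U.2).1
  rwa [Matrix.star_eq_conjTranspose] at h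

omit [NeZero L] in
/-- `conjA h p` has skew-Hermitian slots when `h` is skew-Hermitian. [folklore] -/
theorem conjA_conjTranspose {h : Matrix (Fin 2) (Fin 2) ℂ} (hh : hᴴ = -h)
    (p : (Fin (2 * L - 1 + 1) → GaugeConfig 3 L SU2) × (Site 3 L → SU2)) (w : (Fin (2 * L - 1 + 1) × Edge 3 L) ⊕ Site 3 L) :
    (conjA h p w)ᴴ = -conjA h p w := by
  unfold conjA
  rw [Matrix.conjTranspose_mul, Matrix.conjTranspose_mul, Matrix.conjTranspose_conjTranspose, hh]
  simp only [Matrix.mul_neg, Matrix.neg_mul, Matrix.mul_assoc]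

omit [NeZero L] in
/-- `conjA h p` has traceless slots when `h` is traceless. [folklore] -/
theorem conjA_trace {h : Matrix (Fin 2) (Fin 2) ℂ} (hh0 : h.trace = 0)
    (p : (Fin (2 * L - 1 + 1) → GaugeConfig 3 L SU2) × (Site 3 L → SU2)) (w : (Fin (2 * L - 1 + 1) × Edge 3 L) ⊕ Site 3 L) :
    (conjA h p w).trace = 0 := by
  unfold conjA
  rw [Matrix.mul_assoc, Matrix.trace_mul_comm, Matrix.mul_assoc, coe_mul_conjTranspose_coe, Matrix.mul_one, hh0]

omit [NeZero L] in
/-- `constDir h` has skew-Hermitian slots. [folklore] -/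
theorem constDir_conjTranspose {h : Matrix (Fin 2) (Fin 2) ℂ} (hh : hᴴ = -h) (w : (Fin (2 * L - 1 + 1) × Edge 3 L) ⊕ Site 3 L) :
    (constDir (L := L) h w)ᴴ = -constDir (L := L) h w := hh

omit [NeZero L] in
/-- `constDir h` has traceless slots. [folklore] -/
theorem constDir_trace {h : Matrix (Fin 2) (Fin 2) ℂ} (hh0 : h.trace = 0) (w : (Fin (2 * L - 1 + 1) × Edge 3 L) ⊕ Site 3 L) :
    (constDir (L := L) h w).trace = 0 := hh0

/-! ## §2 The curves: `p·exp(s·conjA) = e^{sh}·p`, `p·exp(s·h) = p·e^{sh}`, and `F₀(k·q) = F₀(q·k)` -/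

omit [NeZero L] in
/-- Matrix identity: for `U ∈ SU(2)`, `U · exp(Uᴴ A U) = exp(A) · U`. [folklore] -/
theorem coe_mul_exp_conj (U : SU2) (A : Matrix (Fin 2) (Fin 2) ℂ) :
    (U : Matrix (Fin 2) (Fin 2) ℂ) * NormedSpace.exp (((U : Matrix (Fin 2) (Fin 2) ℂ))ᴴ * A * (U : Matrix (Fin 2) (Fin 2) ℂ)) =
      NormedSpace.exp A * (U : Matrix (Fin 2) (Fin 2) ℂ) := by
  set V : Matrix (Fin 2) (Fin 2) ℂ := (U : Matrix (Fin 2) (Fin 2) ℂ) with hV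
  have h1 : Vᴴ * V = 1 := conjTranspose_coe_mul_coe U
  have h2 : V * Vᴴ = 1 := coe_mul_conjTranspose_coe U
  have hunit : IsUnit Vᴴ := IsUnit.of_mul_eq_one V h1
  have hinv : (Vᴴ)⁻¹ = V := Matrix.inv_eq_right_inv h1
  have hconj : NormedSpace.exp (Vᴴ * A * V) = Vᴴ * NormedSpace.exp A * V := by
    have h := Matrix.exp_conj Vᴴ A hunit
    rw [hinv] at h
    exact h
  rw [hconj, ← Matrix.mul_assoc, ← Matrix.mul_assoc, h2, Matrix.one_mul]

omit [NeZero L] in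
/-- ★ `p · multiCurve(conjA h p) s = e^{sh} · p`: the right one-parameter curve of `conjA` IS left multiplication by `exp(sh)`. [folklore] -/
theorem mul_multiCurve_conjA {h : Matrix (Fin 2) (Fin 2) ℂ} (hh : hᴴ = -h) (hh0 : h.trace = 0)
    (p : (Fin (2 * L - 1 + 1) → GaugeConfig 3 L SU2) × (Site 3 L → SU2)) (s : ℝ) :
    p * multiCurve (conjA h p) (conjA_conjTranspose hh p) (conjA_trace hh0 p) s = leftConst (expSU hh hh0 s) p := by
  unfold multiCurve leftConst
  refine Prod.ext ?_ ?_
  · funext i e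
    apply Subtype.ext
    show ((p.1 i e : SU2) : Matrix (Fin 2) (Fin 2) ℂ) * NormedSpace.exp (s • conjA h p (Sum.inl (i, e))) =
      NormedSpace.exp (s • h) * ((p.1 i e : SU2) : Matrix (Fin 2) (Fin 2) ℂ)
    have hs : s • conjA h p (Sum.inl (i, e)) =
        ((p.1 i e : SU2) : Matrix (Fin 2) (Fin 2) ℂ)ᴴ * (s • h) * ((p.1 i e : SU2) : Matrix (Fin 2) (Fin 2) ℂ) := by
      unfold conjA varMat
      simp only [Sum.elim_inl, Matrix.mul_smul, Matrix.smul_mul]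
    rw [hs]
    exact coe_mul_exp_conj (p.1 i e) (s • h)
  · funext x
    apply Subtype.ext
    show ((p.2 x : SU2) : Matrix (Fin 2) (Fin 2) ℂ) * NormedSpace.exp (s • conjA h p (Sum.inr x)) =
      NormedSpace.exp (s • h) * ((p.2 x : SU2) : Matrix (Fin 2) (Fin 2) ℂ)
    have hs : s • conjA h p (Sum.inr x) =
        ((p.2 x : SU2) : Matrix (Fin 2) (Fin 2) ℂ)ᴴ * (s • h) * ((p.2 x : SU2) : Matrix (Fin 2) (Fin 2) ℂ) := by
      unfold conjA varMat
      simp only [Sum.elim_inr, Matrix.mul_smul, Matrix.smul_mul]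
    rw [hs]
    exact coe_mul_exp_conj (p.2 x) (s • h)

omit [NeZero L] in
/-- `p · multiCurve(constDir h) s = p · e^{sh}`. [folklore] -/
theorem mul_multiCurve_constDir {h : Matrix (Fin 2) (Fin 2) ℂ} (hh : hᴴ = -h) (hh0 : h.trace = 0)
    (p : (Fin (2 * L - 1 + 1) → GaugeConfig 3 L SU2) × (Site 3 L → SU2)) (s : ℝ) :
    p * multiCurve (constDir h) (constDir_conjTranspose hh) (constDir_trace hh0) s = rightConst (expSU hh hh0 s) p := by
  unfold multiCurve rightConst constDir
  rfl

omit [NeZero L] in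
/-- `(k·q)·r = k·(q·r)`. [folklore] -/
theorem leftConst_mul (k : SU2) (q r : (Fin (2 * L - 1 + 1) → GaugeConfig 3 L SU2) × (Site 3 L → SU2)) :
    leftConst k q * r = leftConst k (q * r) := by
  unfold leftConst
  refine Prod.ext ?_ ?_
  · funext i e; simp only [Prod.fst_mul, Pi.mul_apply, mul_assoc]
  · funext x; simp only [Prod.snd_mul, Pi.mul_apply, mul_assoc]

omit [NeZero L] in
/-- `k⁻¹·(k·q)·k = q·k`. [folklore] -/
theorem conjConst_inv_leftConst (k : SU2) (q : (Fin (2 * L - 1 + 1) → GaugeConfig 3 L SU2) × (Site 3 L → SU2)) :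
    conjConst k⁻¹ (leftConst k q) = rightConst k q := by
  unfold conjConst leftConst rightConst
  refine Prod.ext ?_ ?_
  · funext i e; simp only [inv_inv, inv_mul_cancel_left]
  · funext x; simp only [inv_inv, inv_mul_cancel_left]

/-- Constant gauge invariance: `F₀(k·q·k⁻¹) = F₀(q)` (✓`ringDeficit_ringGaugeAct` with the constant field `k`). [folklore] -/
theorem ringDeficit_conjConst (z : Fin 3 → Bool) (k : SU2) (q : (Fin (2 * L - 1 + 1) → GaugeConfig 3 L SU2) × (Site 3 L → SU2)) :
    ringDeficit L z (conjConst k q) = ringDeficit L z q := by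
  have h := ringDeficit_ringGaugeAct z (fun _ : Site 3 L => k) q
  exact h

/-- ★ `F₀(k·q) = F₀(q·k)`. [folklore] -/
theorem ringDeficit_leftConst_eq_rightConst (z : Fin 3 → Bool) (k : SU2)
    (q : (Fin (2 * L - 1 + 1) → GaugeConfig 3 L SU2) × (Site 3 L → SU2)) :
    ringDeficit L z (leftConst k q) = ringDeficit L z (rightConst k q) := by
  rw [← conjConst_inv_leftConst k q, ringDeficit_conjConst]


/-! ## §3 The two Hessian identities at a zero and the isotropy of the conjugation direction -/

/-- Along the `conjA` curve the deficit equals the deficit along the constant-`h` curve: `F₀(e^{sh}·p) = F₀(p·e^{sh})`. [folklore] -/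
theorem ringDeficit_mul_multiCurve_conjA {h : Matrix (Fin 2) (Fin 2) ℂ} (hh : hᴴ = -h) (hh0 : h.trace = 0)
    (p : (Fin (2 * L - 1 + 1) → GaugeConfig 3 L SU2) × (Site 3 L → SU2)) (s : ℝ) :
    ringDeficit L (fun _ => false) (p * multiCurve (conjA h p) (conjA_conjTranspose hh p) (conjA_trace hh0 p) s) =
      ringDeficit L (fun _ => false) (p * multiCurve (constDir h) (constDir_conjTranspose hh) (constDir_trace hh0) s) := by
  rw [mul_multiCurve_conjA hh hh0, ringDeficit_leftConst_eq_rightConst, ← mul_multiCurve_constDir hh hh0]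

/-- The mixed two-parameter identity: `F₀(e^{sh}·p·e^{th}) = F₀(p·e^{sh}·e^{th})` (both equal `F₀(p·e^{(s+t)h})`). [folklore] -/
theorem ringDeficit_mul_multiCurve_conjA_mul_constDir {h : Matrix (Fin 2) (Fin 2) ℂ} (hh : hᴴ = -h) (hh0 : h.trace = 0)
    (p : (Fin (2 * L - 1 + 1) → GaugeConfig 3 L SU2) × (Site 3 L → SU2)) (s t : ℝ) :
    ringDeficit L (fun _ => false)
        (p * multiCurve (conjA h p) (conjA_conjTranspose hh p) (conjA_trace hh0 p) s *
          multiCurve (constDir h) (constDir_conjTranspose hh) (constDir_trace hh0) t) =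
      ringDeficit L (fun _ => false)
        (p * multiCurve (constDir h) (constDir_conjTranspose hh) (constDir_trace hh0) s *
          multiCurve (constDir h) (constDir_conjTranspose hh) (constDir_trace hh0) t) := by
  rw [mul_multiCurve_conjA hh hh0, leftConst_mul, ringDeficit_leftConst_eq_rightConst,
    ← mul_multiCurve_constDir hh hh0 (p * multiCurve (constDir h) (constDir_conjTranspose hh) (constDir_trace hh0) t) s,
    mul_assoc, mul_assoc, ← multiCurve_add, ← multiCurve_add, add_comm t s]

/-- ★★ **`Ĥ(A,A) = Ĥ(h,h)` at any ring history** (`A = conjA h p`, `h = constDir h`): second derivatives at `0` of the two equal one-parameter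
deficits of `ringDeficit_mul_multiCurve_conjA`. [folklore] -/
theorem frameD_conjA_conjA_eq {h : Matrix (Fin 2) (Fin 2) ℂ} (hh : hᴴ = -h) (hh0 : h.trace = 0)
    (p : (Fin (2 * L - 1 + 1) → GaugeConfig 3 L SU2) × (Site 3 L → SU2)) :
    frameD (conjA h p) (frameD (conjA h p) (ringPoly L)) (ringCoord L p) =
      frameD (constDir h) (frameD (constDir h) (ringPoly L)) (ringCoord L p) := by
  have hA := conjA_conjTranspose hh p
  have hA0 := conjA_trace hh0 p
  have hH : ∀ w, (constDir (L := L) h w)ᴴ = -constDir (L := L) h w := constDir_conjTranspose hh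
  have hH0 : ∀ w, (constDir (L := L) h w).trace = 0 := constDir_trace hh0
  -- first derivatives along both curves agree as functions of `s`
  have hfirst : ∀ s, frameD (conjA h p) (ringPoly L) (ringCoord L (p * multiCurve (conjA h p) hA hA0 s)) =
      frameD (constDir h) (ringPoly L) (ringCoord L (p * multiCurve (constDir h) hH hH0 s)) := by
    intro s
    have h1 := hasDerivAt_ringDeficit_multiCurve (conjA h p) hA hA0 p s
    have h2 := hasDerivAt_ringDeficit_multiCurve (constDir h) hH hH0 p s
    have heq : (fun s => ringDeficit L (fun _ => false) (p * multiCurve (conjA h p) hA hA0 s)) =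
        fun s => ringDeficit L (fun _ => false) (p * multiCurve (constDir h) hH hH0 s) :=
      funext fun s => ringDeficit_mul_multiCurve_conjA hh hh0 p s
    rw [heq] at h1
    exact h1.unique h2
  -- second derivatives at `0`
  have h1 := hasDerivAt_comp_multiCurve (contDiff_frameD (contDiff_ringPoly (L := L)) (conjA h p)) (conjA h p) hA hA0 p 0
  have h2 := hasDerivAt_comp_multiCurve (contDiff_frameD (contDiff_ringPoly (L := L)) (constDir h)) (constDir h) hH hH0 p 0
  have heq : (fun s => frameD (conjA h p) (ringPoly L) (ringCoord L (p * multiCurve (conjA h p) hA hA0 s))) =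
      fun s => frameD (constDir h) (ringPoly L) (ringCoord L (p * multiCurve (constDir h) hH hH0 s)) := funext hfirst
  rw [heq] at h1
  have h := h1.unique h2
  rwa [multiCurve_zero, multiCurve_zero, mul_one] at h

/-- ★★ **`Ĥ(A,h) = Ĥ(h,h)` at any ring history**: the `s`-derivative at `0` of `frameD h F₀ (e^{sh}·p) = frameD h F₀ (p·e^{sh})`, itself the
`t`-derivative at `0` of `ringDeficit_mul_multiCurve_conjA_mul_constDir`. [folklore] -/
theorem frameD_conjA_constDir_eq {h : Matrix (Fin 2) (Fin 2) ℂ} (hh : hᴴ = -h) (hh0 : h.trace = 0)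
    (p : (Fin (2 * L - 1 + 1) → GaugeConfig 3 L SU2) × (Site 3 L → SU2)) :
    frameD (conjA h p) (frameD (constDir h) (ringPoly L)) (ringCoord L p) =
      frameD (constDir h) (frameD (constDir h) (ringPoly L)) (ringCoord L p) := by
  have hA := conjA_conjTranspose hh p
  have hA0 := conjA_trace hh0 p
  have hH : ∀ w, (constDir (L := L) h w)ᴴ = -constDir (L := L) h w := constDir_conjTranspose hh
  have hH0 : ∀ w, (constDir (L := L) h w).trace = 0 := constDir_trace hh0
  -- `frameD h F₀` agrees along the two curves
  have hfirst : ∀ s, frameD (constDir h) (ringPoly L) (ringCoord L (p * multiCurve (conjA h p) hA hA0 s)) =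
      frameD (constDir h) (ringPoly L) (ringCoord L (p * multiCurve (constDir h) hH hH0 s)) := by
    intro s
    have h1 := hasDerivAt_ringDeficit_multiCurve (constDir h) hH hH0 (p * multiCurve (conjA h p) hA hA0 s) 0
    have h2 := hasDerivAt_ringDeficit_multiCurve (constDir h) hH hH0 (p * multiCurve (constDir h) hH hH0 s) 0
    have heq : (fun t => ringDeficit L (fun _ => false) (p * multiCurve (conjA h p) hA hA0 s * multiCurve (constDir h) hH hH0 t)) =
        fun t => ringDeficit L (fun _ => false) (p * multiCurve (constDir h) hH hH0 s * multiCurve (constDir h) hH hH0 t) :=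
      funext fun t => ringDeficit_mul_multiCurve_conjA_mul_constDir hh hh0 p s t
    rw [heq] at h1
    have h := h1.unique h2
    rwa [multiCurve_zero, mul_one, mul_one] at h
  have h1 := hasDerivAt_comp_multiCurve (contDiff_frameD (contDiff_ringPoly (L := L)) (constDir h)) (conjA h p) hA hA0 p 0
  have h2 := hasDerivAt_comp_multiCurve (contDiff_frameD (contDiff_ringPoly (L := L)) (constDir h)) (constDir h) hH hH0 p 0
  have heq : (fun s => frameD (constDir h) (ringPoly L) (ringCoord L (p * multiCurve (conjA h p) hA hA0 s))) =
      fun s => frameD (constDir h) (ringPoly L) (ringCoord L (p * multiCurve (constDir h) hH hH0 s)) := funext hfirst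
  rw [heq] at h1
  have h := h1.unique h2
  rwa [multiCurve_zero, multiCurve_zero, mul_one] at h

omit [NeZero L] in
/-- THE CONJUGATION DIRECTION `Y^h = conjA h p − constDir h` (`w ↦ P_w⁻¹hP_w − h`): the tangent at `p` of the global conjugation orbit
`s ↦ e^{sh}·p·e^{−sh}`. [folklore] -/
def conjDir (h : Matrix (Fin 2) (Fin 2) ℂ) (p : (Fin (2 * L - 1 + 1) → GaugeConfig 3 L SU2) × (Site 3 L → SU2))
    (w : (Fin (2 * L - 1 + 1) × Edge 3 L) ⊕ Site 3 L) : Matrix (Fin 2) (Fin 2) ℂ :=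
  conjA h p w - constDir h w

omit [NeZero L] in
/-- `conjDir` has skew-Hermitian slots. [folklore] -/
theorem conjDir_conjTranspose {h : Matrix (Fin 2) (Fin 2) ℂ} (hh : hᴴ = -h)
    (p : (Fin (2 * L - 1 + 1) → GaugeConfig 3 L SU2) × (Site 3 L → SU2)) (w : (Fin (2 * L - 1 + 1) × Edge 3 L) ⊕ Site 3 L) :
    (conjDir h p w)ᴴ = -conjDir h p w := by
  unfold conjDir
  rw [Matrix.conjTranspose_sub, conjA_conjTranspose hh, constDir_conjTranspose hh, neg_sub_neg, neg_sub]

omit [NeZero L] in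
/-- `conjDir` has traceless slots. [folklore] -/
theorem conjDir_trace {h : Matrix (Fin 2) (Fin 2) ℂ} (hh0 : h.trace = 0)
    (p : (Fin (2 * L - 1 + 1) → GaugeConfig 3 L SU2) × (Site 3 L → SU2)) (w : (Fin (2 * L - 1 + 1) × Edge 3 L) ⊕ Site 3 L) :
    (conjDir h p w).trace = 0 := by
  unfold conjDir
  rw [Matrix.trace_sub, conjA_trace hh0, constDir_trace hh0, sub_zero]

omit [NeZero L] in
/-- `conjDir` vanishes at a variable equal to `1`. [folklore] -/
theorem conjDir_eq_zero_of_eq_one (h : Matrix (Fin 2) (Fin 2) ℂ) (p : (Fin (2 * L - 1 + 1) → GaugeConfig 3 L SU2) × (Site 3 L → SU2))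
    {w : (Fin (2 * L - 1 + 1) × Edge 3 L) ⊕ Site 3 L} (hw : varMat p w = 1) : conjDir h p w = 0 := by
  unfold conjDir conjA constDir
  rw [hw]
  simp

omit [NeZero L] in
/-- `conjDir` as the two-slot combination `1·conjA + (−1)·constDir`. [folklore] -/
theorem dirOf_pair_eq_conjDir (h : Matrix (Fin 2) (Fin 2) ℂ) (p : (Fin (2 * L - 1 + 1) → GaugeConfig 3 L SU2) × (Site 3 L → SU2)) :
    dirOf (![conjA h p, constDir h] : Fin 2 → ((Fin (2 * L - 1 + 1) × Edge 3 L) ⊕ Site 3 L) → Matrix (Fin 2) (Fin 2) ℂ) ![(1 : ℝ), -1] =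
      conjDir h p := by
  funext w
  rw [dirOf, Finset.sum_apply, Fin.sum_univ_two]
  simp only [Pi.smul_apply, Matrix.cons_val_zero, Matrix.cons_val_one, one_smul, neg_smul, conjDir, sub_eq_add_neg]

/-- ★★★ **THE CONJUGATION DIRECTION IS ISOTROPIC AT A ZERO**: `∂_{Y^h}∂_{Y^h} F₀ (p) = 0` whenever `F₀(p) = 0`
(`= Ĥ(A,A) − Ĥ(A,h) − Ĥ(h,A) + Ĥ(h,h)` with all four equal at a zero). [cite: Luscher1983, §2] [folklore] -/
theorem frameD_conjDir_isotropic {h : Matrix (Fin 2) (Fin 2) ℂ} (hh : hᴴ = -h) (hh0 : h.trace = 0)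
    {p : (Fin (2 * L - 1 + 1) → GaugeConfig 3 L SU2) × (Site 3 L → SU2)} (hp : ringDeficit L (fun _ => false) p = 0) :
    frameD (conjDir h p) (frameD (conjDir h p) (ringPoly L)) (ringCoord L p) = 0 := by
  have hAA := frameD_conjA_conjA_eq hh hh0 p
  have hAH := frameD_conjA_constDir_eq hh hh0 p
  have hHA : frameD (constDir h) (frameD (conjA h p) (ringPoly L)) (ringCoord L p) =
      frameD (conjA h p) (frameD (constDir h) (ringPoly L)) (ringCoord L p) :=
    frameD_frameD_symm_of_zero (constDir_conjTranspose hh) (conjA_conjTranspose hh p) hp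
  rw [← dirOf_pair_eq_conjDir, frameD_dirOf_frameD_dirOf]
  simp only [dotProduct, mulVec, Fin.sum_univ_two, frameHessRaw, Matrix.cons_val_zero, Matrix.cons_val_one]
  rw [hAA, hHA, hAH]
  ring

/-! ## §4 Kernel vectors of the standard `X_fix` frame Hessian -/

/-- ★★★ **THE CONJUGATION DIRECTIONS ARE EXACT KERNEL VECTORS** of the raw frame Hessian in the standard `X_fix` frame: at any zero `p` of `F₀`
whose slice-`0` tree links are `1` and for any skew-Hermitian traceless `h`, `Ĥ(p)·fixCoord(conjDir h p) = 0`. [cite: Luscher1983, §2] -/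
theorem frameHessRaw_mulVec_fixCoord_conjDir_eq_zero {h : Matrix (Fin 2) (Fin 2) ℂ} (hh : hᴴ = -h) (hh0 : h.trace = 0)
    {p : (Fin (2 * L - 1 + 1) → GaugeConfig 3 L SU2) × (Site 3 L → SU2)} (hp : ringDeficit L (fun _ => false) p = 0)
    (htree : ∀ e : Edge 3 L, treeEdge e = true → p.1 0 e = 1) :
    frameHessRaw (L := L) fixFrameStd (ringCoord L p) *ᵥ fixCoord (conjDir h p) = 0 := by
  have hY : dirOf (fixFrameStd (L := L)) (fixCoord (conjDir h p)) = conjDir h p :=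
    dirOf_fixFrameStd_fixCoord (conjDir_conjTranspose hh p) (conjDir_trace hh0 p)
      (fun e he => conjDir_eq_zero_of_eq_one h p (show varMat p (Sum.inl (0, e)) = 1 from htree e he))
  refine mulVec_eq_zero_of_nonneg_of_isotropic (frameHessRaw_transpose_of_zero fixFrameStd fixFrameStd_conjTranspose hp)
    (frameHessRaw_nonneg_of_zero fixFrameStd fixFrameStd_conjTranspose fixFrameStd_trace hp) ?_
  rw [← frameD_dirOf_frameD_dirOf, hY]
  exact frameD_conjDir_isotropic hh hh0 hp

/-- The same for the symmetrised Hessian. [folklore] -/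
theorem frameHess_mulVec_fixCoord_conjDir_eq_zero {h : Matrix (Fin 2) (Fin 2) ℂ} (hh : hᴴ = -h) (hh0 : h.trace = 0)
    {p : (Fin (2 * L - 1 + 1) → GaugeConfig 3 L SU2) × (Site 3 L → SU2)} (hp : ringDeficit L (fun _ => false) p = 0)
    (htree : ∀ e : Edge 3 L, treeEdge e = true → p.1 0 e = 1) :
    frameHess (L := L) fixFrameStd (ringCoord L p) *ᵥ fixCoord (conjDir h p) = 0 := by
  rw [frameHess_eq_frameHessRaw_of_zero fixFrameStd fixFrameStd_conjTranspose hp]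
  exact frameHessRaw_mulVec_fixCoord_conjDir_eq_zero hh hh0 hp htree

end Summit.QuantumFields.YangMills.Theorems.VirialFluxGap.FixFrame

end
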